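import Summits.KontsevichZagierPeriods.KontsevichZagierPeriods.Theses.HardSphereVirial
import Summits.KontsevichZagierPeriods.KontsevichZagierPeriods.Theorems.InverseLandauTateLiftingIsotropySpace

/-!
# `IsotropyFactorisation3` (stmt-KontsevichZagierPeriods-10457, route HardSphereVirial) — candidate proof

The O(3) engine of route HardSphereVirial is, verbatim, the landed theorem
`Summit.KontsevichZagierPeriods.InverseLandau.tateLifting_isotropySpaceMove`
(`Theorems/InverseLandauTateLiftingIsotropySpace.lean`, p138370, std axioms), proved as stub 53 of line `Sketch` of
crux `TateLifting` (stmt-9129). This file closes stmt-10457 by that term.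
-/

namespace Summit.KontsevichZagierPeriods.HardSphereVirial

/-- **The O(3) engine** (route HardSphereVirial, crux `IsotropyFactorisation3`, stmt-KontsevichZagierPeriods-10457): for every
`ℚ`-semialgebraic `σ ⊆ (ℝ³)³` invariant under the diagonal action of `O(3)`, `[σ, 1] − [ℝ² × τ, 4ρ²/(1+a²+b²)²] ∈ KZ.relations`
— one rational rule-(2) move (inverse stereographic direction, rational rotation frame) after excising a null set.
Proof: the landed `InverseLandau.tateLifting_isotropySpaceMove` (p138370). [cite: KontsevichZagier2001, §1.2 rule (2)] -/
theorem isotropyFactorisation3_proof :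
    Summit.KontsevichZagierPeriods.KontsevichZagierPeriods.Theses.HardSphereVirial.IsotropyFactorisation3 :=
  Summit.KontsevichZagierPeriods.InverseLandau.tateLifting_isotropySpaceMove

end Summit.KontsevichZagierPeriods.HardSphereVirial
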